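import Summits.KontsevichZagierPeriods.KontsevichZagierPeriods.Theorems.StuffleInKZ.Negative.AlgebraicShadow
import Literature.NumberTheory.Transcendental.KZSubcalculusInvariants
import Literature.NumberTheory.Transcendental.KZIntervalPeriodProofs
import Summits.KontsevichZagierPeriods.KontsevichZagierPeriods.Theorems.LogPrimitiveNL.Negative.DimZero
import Summits.KontsevichZagierPeriods.KontsevichZagierPeriods.Theorems.LogPrimitiveNL.Negative.Strengthenings

/-!
# Crux `HurwitzMicroSectors.NormalFormPrinciple` (stmt-KontsevichZagierPeriods-3869) — negative side II:
an ARITHMETIC invariant of the change-of-variables-free sub-calculus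

Landed copy of §4.3 (invariant part) of `Cruxes/NormalFormPrinciple/Disproof.lean` (cdisprove,
2026-08-16). The tree already has one additive invariant of
`covFreeRelations = closure (domainAddRel ∪ integrandAddRel ∪ newtonLeibnizRel)` finer than `eval`:
the ALGEBRAIC SHADOW of the first-axis marginal (`StuffleInKZ.Negative.covFreeRelations_le_algShadow`,
functional transcendence). This file gives a second one of a different nature:

  `Λcov [σ, f] := (∫_{σ ∩ {0 < x₀ < 1}} f) mod (ℚ̄ ∩ ℝ)` in dimension `≥ 1`, `0` in dimension `0`,

and `covFreeRelations ≤ ker Λcov` (`covFreeRelations_le_ker_Λcov`): rules 1a/1b preserve the windowed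
value exactly (`KZ.closure_add_le_ker_restrictedEval`); a Newton–Leibniz move `k+2 → k+1` restricts
to the window (a cylinder over the base: the windowed representations are again a Newton–Leibniz
instance, soundness applies); a Newton–Leibniz move `1 → 0` has windowed value
`F(min(b,1)) − F(max(a,0))`, a difference of values of a `ℚ`-semialgebraic function over the point,
hence ALGEBRAIC (`isAlgebraic_of_isSemialgebraicFunOn_fin_zero`, tree). The two invariants are
incomparable: `Λcov` sees the arithmetic of values where the shadow sees functional transcendence;
the witness separating them (the arctangent reflection pair, which HAS an algebraic shadow) is in
`ArctanWitness.lean`. References: [KontsevichZagier2001, §1.2]; Lindemann 1882 (for the witness).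
-/

noncomputable section

set_option linter.dupNamespace false

open MeasureTheory Set intervalIntegral
open Literature.NumberTheory.Transcendental Literature.NumberTheory.Transcendental.KZ
open Literature.ModelTheory.ExponentialFields (IsSemialgebraic)

namespace Summit.KontsevichZagierPeriods.HurwitzMicroSectors.NormalFormPrinciple.Negative

open Summit.KontsevichZagierPeriods.LiouvilleUnfolding.LogPrimitiveNL.Negative
  (isSemialgebraicFunOn_endpoint isAlgebraic_of_isSemialgebraicFunOn_fin_zero snoc_eq_const)
open Summit.KontsevichZagierPeriods.Theorems.StuffleInKZ.Negative (covFreeRelations)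

variable {n m : ℕ}

/-! ## Transfer helpers `ℝ¹ ↔ ℝ` -/

/-- Transfer of set integrals on `ℝ¹` to `ℝ`. -/
theorem setIntegral_fin_one (g : (Fin 1 → ℝ) → ℝ) (T : Set ℝ) :
    ∫ z in {z : Fin 1 → ℝ | z 0 ∈ T}, g z = ∫ t in T, g (fun _ => t) := by
  have hmp := MeasureTheory.volume_preserving_funUnique (Fin 1) ℝ
  have hpre : {z : Fin 1 → ℝ | z 0 ∈ T} = MeasurableEquiv.funUnique (Fin 1) ℝ ⁻¹' T := by
    ext x; simp [MeasurableEquiv.funUnique, Fin.default_eq_zero]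
  have h1 := hmp.setIntegral_preimage_emb (MeasurableEquiv.measurableEmbedding _)
    (fun t => g (fun _ => t)) T
  rw [hpre, ← h1]
  congr 1
  ext x
  congr 1
  ext i
  simp [MeasurableEquiv.funUnique, Fin.default_eq_zero, Subsingleton.elim i 0]

/-- Transfer of integrability on `ℝ¹` to `ℝ`. -/
theorem integrableOn_fin_one {g : (Fin 1 → ℝ) → ℝ} {T : Set ℝ} :
    IntegrableOn g {z : Fin 1 → ℝ | z 0 ∈ T} ↔ IntegrableOn (fun t => g (fun _ => t)) T := by
  have hmp := MeasureTheory.volume_preserving_funUnique (Fin 1) ℝ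
  have hpre : {z : Fin 1 → ℝ | z 0 ∈ T} = MeasurableEquiv.funUnique (Fin 1) ℝ ⁻¹' T := by
    ext x; simp [MeasurableEquiv.funUnique, Fin.default_eq_zero]
  have hcomp : ((fun t => g (fun _ => t)) ∘ MeasurableEquiv.funUnique (Fin 1) ℝ) = g := by
    ext x
    simp only [Function.comp_apply]
    congr 1
    ext i
    simp [MeasurableEquiv.funUnique, Fin.default_eq_zero, Subsingleton.elim i 0]
  rw [hpre]
  conv_lhs => rw [← hcomp]
  exact hmp.integrableOn_comp_preimage (MeasurableEquiv.measurableEmbedding _)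

/-- The first coordinate survives `Fin.init` (dimension `≥ 2`). -/
theorem init_apply_zero {k : ℕ} (z : Fin (k + 2) → ℝ) : Fin.init z 0 = z 0 := by
  simp [Fin.init]

/-! ## The window, the windowed evaluation, and `Λcov` -/

/-- The window family: nothing in dimension `0`, the first-coordinate slab `0 < x₀ < 1` above. -/
def wnd : (n : ℕ) → Set (Fin n → ℝ)
  | 0 => ∅
  | _ + 1 => {x | x 0 ∈ Ioo (0:ℝ) 1}

/-- No window in dimension `0`. -/
@[simp] theorem wnd_zero : wnd 0 = ∅ := rfl

/-- The window in positive dimension is the slab `0 < x₀ < 1`. -/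
theorem wnd_succ (k : ℕ) : wnd (k + 1) = {x : Fin (k + 1) → ℝ | x 0 ∈ Ioo (0:ℝ) 1} := rfl

/-- The windows are `ℚ`-semialgebraic. -/
theorem isSemialgebraic_wnd : ∀ n, IsSemialgebraic ℚ (wnd n)
  | 0 => Literature.ModelTheory.ExponentialFields.isSemialgebraic_empty
  | k + 1 => by
    have h1 := Literature.ModelTheory.ExponentialFields.isSemialgebraic_setOf_eval_pos (k := ℚ)
      (R := ℝ) (MvPolynomial.X 0 : MvPolynomial (Fin (k + 1)) ℚ)
    have h2 := Literature.ModelTheory.ExponentialFields.isSemialgebraic_setOf_eval_lt (k := ℚ)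
      (R := ℝ) (MvPolynomial.X 0 : MvPolynomial (Fin (k + 1)) ℚ) (1 : MvPolynomial (Fin (k + 1)) ℚ)
    simp only [MvPolynomial.aeval_X, map_one] at h1 h2
    convert h1.inter h2 using 1
    ext x
    simp [wnd_succ, mem_Ioo]

/-- The windows are measurable. -/
theorem measurableSet_wnd (n : ℕ) : MeasurableSet (wnd n) :=
  Literature.ModelTheory.ExponentialFields.IsSemialgebraic.measurableSet_holds (isSemialgebraic_wnd n)

/-- **The windowed evaluation**: integrate each generator over `domain ∩ {0 < x₀ < 1}` only
(`0` in dimension `0`). -/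
def windowEval : FormalRep →+ ℝ := restrictedEval wnd

/-- Windowed evaluation of a generator. -/
@[simp] theorem windowEval_of (r : IntegralRep n) :
    windowEval (of r) = ∫ x in r.domain ∩ wnd n, r.integrand x :=
  restrictedEval_of wnd r

/-- The additive group of real algebraic numbers. -/
def algReal : AddSubgroup ℝ := (integralClosure ℚ ℝ).toSubring.toAddSubgroup

/-- Membership in `algReal` is algebraicity over `ℚ`. -/
theorem mem_algReal {x : ℝ} : x ∈ algReal ↔ IsAlgebraic ℚ x := by
  simp [algReal, mem_integralClosure_iff, isAlgebraic_iff_isIntegral]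

/-- **The invariant of the calculus without rule 2)**: windowed evaluation modulo `ℚ̄ ∩ ℝ`. -/
def Λcov : FormalRep →+ ℝ ⧸ algReal := (QuotientAddGroup.mk' algReal).comp windowEval

/-- `Λcov c = 0` iff the windowed value of `c` is algebraic. -/
theorem Λcov_eq_zero_iff (c : FormalRep) : Λcov c = 0 ↔ windowEval c ∈ algReal :=
  QuotientAddGroup.eq_zero_iff _

/-- Rules 1a, 1b preserve the windowed evaluation exactly. -/
theorem windowEval_eq_zero_of_mem_add {c : FormalRep} (hc : c ∈ domainAddRel ∪ integrandAddRel) :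
    windowEval c = 0 :=
  closure_add_le_ker_restrictedEval wnd measurableSet_wnd (AddSubgroup.subset_closure hc)

/-- **Rule 3) from dimension `k + 2` to `k + 1` preserves the windowed evaluation exactly**: the
window is a cylinder over the base, so the windowed representations form a Newton–Leibniz
instance themselves and soundness applies. -/
theorem windowEval_nl_succ {k : ℕ} (r : IntegralRep (k + 2)) (r' : IntegralRep (k + 1))
    (a b : (Fin (k + 1) → ℝ) → ℝ) (F : (Fin (k + 2) → ℝ) → ℝ)
    (hF : IsSemialgebraicFunOn ℚ r.domain F)
    (ha : IsSemialgebraicFunOn ℚ r'.domain a) (hb : IsSemialgebraicFunOn ℚ r'.domain b)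
    (hab : ∀ x ∈ r'.domain, a x ≤ b x)
    (hdom : r.domain = {z | (Fin.init z : Fin (k + 1) → ℝ) ∈ r'.domain ∧
      a (Fin.init z) ≤ z (Fin.last (k + 1)) ∧ z (Fin.last (k + 1)) ≤ b (Fin.init z)})
    (hcont : ∀ x ∈ r'.domain, ContinuousOn (fun t : ℝ => F (Fin.snoc x t)) (Icc (a x) (b x)))
    (hderiv : ∀ x ∈ r'.domain, ∀ t ∈ Ioo (a x) (b x),
      HasDerivAt (fun s : ℝ => F (Fin.snoc x s)) (r.integrand (Fin.snoc x t)) t)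
    (hbdry : ∀ x ∈ r'.domain, r'.integrand x = F (Fin.snoc x (b x)) - F (Fin.snoc x (a x))) :
    windowEval (of r - of r') = 0 := by
  have hW : IsSemialgebraic ℚ (r.domain ∩ wnd (k + 2)) :=
    r.isSemialgebraic_domain.inter (isSemialgebraic_wnd _)
  have hW' : IsSemialgebraic ℚ (r'.domain ∩ wnd (k + 1)) :=
    r'.isSemialgebraic_domain.inter (isSemialgebraic_wnd _)
  set rW := r.restrict _ hW inter_subset_left with hrW
  set r'W := r'.restrict _ hW' inter_subset_left with hr'W
  have hmem : of rW - of r'W ∈ newtonLeibnizRel := by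
    refine ⟨k + 1, rW, r'W, a, b, F, hF.mono inter_subset_left hW,
      ha.mono inter_subset_left hW', hb.mono inter_subset_left hW', fun x hx => hab x hx.1, ?_,
      fun x hx => hcont x hx.1, fun x hx t ht => hderiv x hx.1 t ht, fun x hx => hbdry x hx.1, rfl⟩
    ext z
    simp only [hrW, hr'W, IntegralRep.domain_restrict, mem_inter_iff, hdom, mem_setOf_eq, wnd_succ,
      init_apply_zero]
    tauto
  have h0 := eval_eq_zero_of_mem_newtonLeibnizRel_holds hmem
  simp only [map_sub, eval_of, sub_eq_zero] at h0
  rw [map_sub, windowEval_of, windowEval_of, sub_eq_zero]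
  exact h0

/-! ## Rule 3) from dimension `1` to `0`: the windowed value is ALGEBRAIC -/

section DimOne

/-- `max(a, 0) = (a + |a|)/2` is semialgebraic when `a` is. -/
theorem isSemialgebraicFunOn_max_zero {m : ℕ} {s : Set (Fin m → ℝ)} (hs : IsSemialgebraic ℚ s)
    {a : (Fin m → ℝ) → ℝ} (ha : IsSemialgebraicFunOn ℚ s a) :
    IsSemialgebraicFunOn ℚ s (fun x => max (a x) 0) := by
  have h : IsSemialgebraicFunOn ℚ s (fun x => ((1 / 2 : ℚ) : ℝ) * (a x + |a x|)) :=
    IsSemialgebraicFunOn.mul_holds (isSemialgebraicFunOn_ratCast hs (1 / 2))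
      (IsSemialgebraicFunOn.add_holds ha ha.abs)
  refine h.congr fun x _ => ?_
  simp only
  rcases le_total 0 (a x) with h0 | h0
  · rw [max_eq_left h0, abs_of_nonneg h0]; push_cast; ring
  · rw [max_eq_right h0, abs_of_nonpos h0]; push_cast; ring

/-- `min(b, 1) = (b + 1 − |b − 1|)/2` is semialgebraic when `b` is. -/
theorem isSemialgebraicFunOn_min_one {m : ℕ} {s : Set (Fin m → ℝ)} (hs : IsSemialgebraic ℚ s)
    {b : (Fin m → ℝ) → ℝ} (hb : IsSemialgebraicFunOn ℚ s b) :
    IsSemialgebraicFunOn ℚ s (fun x => min (b x) 1) := by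
  have h1 : IsSemialgebraicFunOn ℚ s (fun x => b x - ((1 : ℚ) : ℝ)) :=
    IsSemialgebraicFunOn.sub_holds hb (isSemialgebraicFunOn_ratCast hs 1)
  have h : IsSemialgebraicFunOn ℚ s
      (fun x => ((1 / 2 : ℚ) : ℝ) * ((b x + ((1 : ℚ) : ℝ)) - |b x - ((1 : ℚ) : ℝ)|)) :=
    IsSemialgebraicFunOn.mul_holds (isSemialgebraicFunOn_ratCast hs (1 / 2))
      (IsSemialgebraicFunOn.sub_holds (IsSemialgebraicFunOn.add_holds hb (isSemialgebraicFunOn_ratCast hs 1)) h1.abs)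
  refine h.congr fun x _ => ?_
  simp only
  rcases le_total (b x) 1 with h0 | h0
  · rw [min_eq_left h0, abs_of_nonpos (by push_cast; linarith)]; push_cast; ring
  · rw [min_eq_right h0, abs_of_nonneg (by push_cast; linarith)]; push_cast; ring

/-- **Rule 3) from dimension `1` to `0` has ALGEBRAIC windowed value.** Over the point, the band is
`[a, b] ⊂ ℝ¹` with `a ≤ b` algebraic, and `∫_{[a,b] ∩ (0,1)} F' = F(min(b,1)) − F(max(a,0))` (or
`0`) is a difference of values of the `ℚ`-semialgebraic `F` at semialgebraic endpoints — algebraic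
numbers (`isAlgebraic_of_isSemialgebraicFunOn_fin_zero`). -/
theorem windowEval_nl_zero (r : IntegralRep 1) (r' : IntegralRep 0)
    (a b : (Fin 0 → ℝ) → ℝ) (F : (Fin 1 → ℝ) → ℝ)
    (hF : IsSemialgebraicFunOn ℚ r.domain F)
    (ha : IsSemialgebraicFunOn ℚ r'.domain a) (hb : IsSemialgebraicFunOn ℚ r'.domain b)
    (hab : ∀ x ∈ r'.domain, a x ≤ b x)
    (hdom : r.domain = {z | (Fin.init z : Fin 0 → ℝ) ∈ r'.domain ∧
      a (Fin.init z) ≤ z (Fin.last 0) ∧ z (Fin.last 0) ≤ b (Fin.init z)})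
    (hcont : ∀ x ∈ r'.domain, ContinuousOn (fun t : ℝ => F (Fin.snoc x t)) (Icc (a x) (b x)))
    (hderiv : ∀ x ∈ r'.domain, ∀ t ∈ Ioo (a x) (b x),
      HasDerivAt (fun s : ℝ => F (Fin.snoc x s)) (r.integrand (Fin.snoc x t)) t) :
    windowEval (of r - of r') ∈ algReal := by
  rw [map_sub, windowEval_of, windowEval_of, wnd_zero, inter_empty, Measure.restrict_empty,
    integral_zero_measure, sub_zero, mem_algReal]
  rcases (r'.domain).eq_empty_or_nonempty with hτ | ⟨x₀, hx₀⟩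
  · -- empty base: empty band
    have hband : r.domain = ∅ := by
      rw [hdom, eq_empty_iff_forall_notMem]
      rintro z ⟨hz, -⟩
      rw [hτ] at hz
      exact hz
    rw [hband, empty_inter, Measure.restrict_empty, integral_zero_measure]
    exact isAlgebraic_zero
  · -- base = the point `x₀`
    have hall : ∀ y : Fin 0 → ℝ, y = x₀ := fun y => Subsingleton.elim y x₀
    set a₀ := a x₀ with ha₀
    set b₀ := b x₀ with hb₀
    set α := max a₀ 0 with hα
    set β := min b₀ 1 with hβ
    have hab₀ : a₀ ≤ b₀ := hab x₀ hx₀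
    -- the band and the windowed band as subsets of `ℝ¹`
    have hband : r.domain = {z : Fin 1 → ℝ | z 0 ∈ Icc a₀ b₀} := by
      rw [hdom]
      ext z
      simp only [mem_setOf_eq, mem_Icc, hall (Fin.init z), hx₀, true_and]
      rfl
    have hset : r.domain ∩ wnd 1 = {z : Fin 1 → ℝ | z 0 ∈ Icc a₀ b₀ ∩ Ioo 0 1} := by
      rw [hband, wnd_succ]
      ext z
      simp only [mem_inter_iff, mem_setOf_eq]
    rw [hset, setIntegral_fin_one]
    -- the one-variable data
    set G : ℝ → ℝ := fun s => F (Fin.snoc x₀ s) with hG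
    set f : ℝ → ℝ := fun t => r.integrand (fun _ => t) with hf
    have hT_sub : Icc a₀ b₀ ∩ Ioo 0 1 ⊆ Icc α β := by
      rintro t ⟨⟨h1, h2⟩, h3, h4⟩
      exact ⟨max_le h1 h3.le, le_min h2 h4.le⟩
    by_cases hαβ : α < β
    · -- non-degenerate window: FTC on `[α, β] ⊆ [a₀, b₀]`
      have hαa : a₀ ≤ α := le_max_left _ _
      have hβb : β ≤ b₀ := min_le_left _ _
      have hIoo_sub : Ioo α β ⊆ Icc a₀ b₀ ∩ Ioo 0 1 := by
        rintro t ⟨h1, h2⟩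
        refine ⟨⟨by linarith, by linarith⟩, ?_, ?_⟩
        · exact lt_of_le_of_lt (le_max_right _ _) h1
        · exact lt_of_lt_of_le h2 (min_le_right _ _)
      have hae : (Icc a₀ b₀ ∩ Ioo 0 1 : Set ℝ) =ᵐ[volume] (Ioo α β : Set ℝ) := by
        refine (ae_eq_set).mpr ⟨?_, ?_⟩
        · refine measure_mono_null (fun t ht => ?_) (Set.Finite.measure_zero (toFinite {α, β}) volume)
          obtain ⟨hT, hnot⟩ := ht
          have ⟨h1, h2⟩ := hT_sub hT
          simp only [mem_Ioo, not_and_or, not_lt] at hnot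
          rcases hnot with h | h
          · exact Or.inl (le_antisymm h h1)
          · exact Or.inr (le_antisymm h2 h)
        · rw [Set.sdiff_eq_empty.mpr hIoo_sub]
          exact measure_empty
      rw [setIntegral_congr_set hae]
      -- FTC
      have hcont' : ContinuousOn G (Icc α β) := by
        refine (hcont x₀ hx₀).mono (Icc_subset_Icc hαa hβb)
      have hderiv' : ∀ t ∈ Ioo α β, HasDerivAt G (f t) t := by
        intro t ht
        have := hderiv x₀ hx₀ t ⟨lt_of_le_of_lt hαa ht.1, lt_of_lt_of_le ht.2 hβb⟩
        simpa [hG, hf, snoc_eq_const] using this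
      have hint : IntervalIntegrable f volume α β := by
        rw [intervalIntegrable_iff_integrableOn_Ioo_of_le hαβ.le]
        have h1 : IntegrableOn r.integrand {z : Fin 1 → ℝ | z 0 ∈ Ioo α β} := by
          refine r.integrableOn.mono_set ?_
          rw [hband]
          rintro z ⟨h1, h2⟩
          exact ⟨by linarith, by linarith⟩
        exact integrableOn_fin_one.mp h1
      have hFTC := integral_eq_sub_of_hasDerivAt_of_le hαβ.le hcont' hderiv' hint
      rw [integral_of_le hαβ.le, integral_Ioc_eq_integral_Ioo] at hFTC
      rw [hFTC]
      -- algebraicity of the two endpoint values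
      have hτ : IsSemialgebraic ℚ r'.domain := r'.isSemialgebraic_domain
      have hβmem : ∀ y ∈ r'.domain, (Fin.snoc y (min (b y) 1) : Fin 1 → ℝ) ∈ r.domain := by
        intro y _
        rw [hall y, hband]
        simp only [mem_setOf_eq, mem_Icc, snoc_eq_const]
        refine ⟨?_, min_le_left _ _⟩
        exact le_trans hαa (le_of_lt hαβ)
      have hαmem : ∀ y ∈ r'.domain, (Fin.snoc y (max (a y) 0) : Fin 1 → ℝ) ∈ r.domain := by
        intro y _
        rw [hall y, hband]
        simp only [mem_setOf_eq, mem_Icc, snoc_eq_const]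
        exact ⟨le_max_left _ _, le_trans (le_of_lt hαβ) hβb⟩
      have hGβ : IsAlgebraic ℚ (G β) := by
        have hsemi := isSemialgebraicFunOn_endpoint hτ (isSemialgebraicFunOn_min_one hτ hb) hF hβmem
        exact isAlgebraic_of_isSemialgebraicFunOn_fin_zero hsemi hx₀
      have hGα : IsAlgebraic ℚ (G α) := by
        have hsemi := isSemialgebraicFunOn_endpoint hτ (isSemialgebraicFunOn_max_zero hτ ha) hF hαmem
        exact isAlgebraic_of_isSemialgebraicFunOn_fin_zero hsemi hx₀
      exact hGβ.sub hGα
    · -- degenerate window: null set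
      have hnull : volume (Icc a₀ b₀ ∩ Ioo 0 1 : Set ℝ) = 0 := by
        refine measure_mono_null hT_sub ?_
        rw [Real.volume_Icc, ENNReal.ofReal_eq_zero]
        linarith [not_lt.mp hαβ]
      rw [Measure.restrict_eq_zero.mpr hnull, integral_zero_measure]
      exact isAlgebraic_zero

end DimOne

/-- Rule 3) shifts the windowed evaluation by an algebraic number. -/
theorem windowEval_mem_algReal_of_mem_newtonLeibnizRel {c : FormalRep} (hc : c ∈ newtonLeibnizRel) :
    windowEval c ∈ algReal := by
  obtain ⟨k, r, r', a, b, F, hF, ha, hb, hab, hdom, hcont, hderiv, hbdry, rfl⟩ := hc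
  cases k with
  | zero => exact windowEval_nl_zero r r' a b F hF ha hb hab hdom hcont hderiv
  | succ k =>
    rw [windowEval_nl_succ r r' a b F hF ha hb hab hdom hcont hderiv hbdry]
    exact algReal.zero_mem

/-- **Rules 1a, 1b, 3 preserve `Λcov`**: every change-of-variables-free relation
(`StuffleInKZ.Negative.covFreeRelations`) has algebraic windowed value. -/
theorem covFreeRelations_le_ker_Λcov : covFreeRelations ≤ Λcov.ker := by
  refine (AddSubgroup.closure_le _).mpr ?_
  rintro c (hc | hc)
  · rw [SetLike.mem_coe, AddMonoidHom.mem_ker, Λcov_eq_zero_iff, windowEval_eq_zero_of_mem_add hc]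
    exact algReal.zero_mem
  · rw [SetLike.mem_coe, AddMonoidHom.mem_ker, Λcov_eq_zero_iff]
    exact windowEval_mem_algReal_of_mem_newtonLeibnizRel hc

end Summit.KontsevichZagierPeriods.HurwitzMicroSectors.NormalFormPrinciple.Negative
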